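import Summits.ValiantsHypothesis.Statement
import Literature.Computability.AlgebraicComplexity.OrbitClosure
import Literature.Computability.AlgebraicComplexity.DeterminantalComplexity
import Literature.Computability.AlgebraicComplexity.GCTObstructions
import Literature.Computability.AlgebraicComplexity.GCT
import Literature.Computability.AlgebraicComplexity.OrbitCoordinateRing
import Literature.Computability.AlgebraicComplexity.PermanentVsDeterminant
import Literature.Computability.AlgebraicComplexity.CircuitDepth
import Literature.Computability.AlgebraicComplexity.VPDeterminantalQP
import Literature.Computability.AlgebraicComplexity.EquivariantDC
import Literature.Computability.AlgebraicComplexity.LandsbergRessayre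
import Literature.Computability.AlgebraicComplexity.BIPNoOccurrence
import Literature.Computability.AlgebraicComplexity.ValiantBooleanBridge
import Mathlib

/-!
# ValiantsHypothesis / GCTMult — assembly

Route `ValiantsHypothesis/GCTMult`, item `stmt-ValiantsHypothesis-0324` (assembly): the
quasi-polynomial Mulmuley–Sohoni thesis (padded `per_n ∉ Δ[det_m]` for all large `n` and all
`n ≤ m ≤ 2^((log₂ n + c)^c)`) implies that `dc(per_n)` is not quasi-polynomially bounded — given,
as hypotheses, Mulmuley–Sohoni 2001 Prop. 4.4
(`Literature.Computability.AlgebraicComplexity.paddedPerPoly_mem_orbitClosure_detPoly_of_hasDetRepr`), attainment of `dc`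
(`hasDetRepr_determinantalComplexity`) and padding (`HasDetRepr.mono`). Elementary glue: from a
bound `dc(per_n) ≤ 2^((log₂ n + c)^c)` take `m := max (dc per_n) (max n 1) ≤ 2^((log₂ n + (c+1))^(c+1))`.

(`import Mathlib` + the topic's Literature files: sibling signatures of the route are elaborated by
the gate in this file's context.)
-/

namespace Literature.CplxAlg

/-- Padding a quasi-polynomial exponent: `(a + c)^c ≤ (a + (c + 1))^(c + 1)`. [folklore] -/
theorem add_pow_le_add_succ_pow_succ (a c : ℕ) : (a + c) ^ c ≤ (a + (c + 1)) ^ (c + 1) :=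
  calc (a + c) ^ c ≤ (a + (c + 1)) ^ c := Nat.pow_le_pow_left (by omega) c
    _ ≤ (a + (c + 1)) ^ (c + 1) := Nat.pow_le_pow_right (by omega) (by omega)

/-- Settles `stmt-ValiantsHypothesis-0324` (assembly of route GCTMult): the quasi-polynomial
Mulmuley–Sohoni thesis, together with MS 2001 Prop. 4.4, attainment and monotonicity of
determinantal representations of `per_n` (all as hypotheses), gives that
`n ↦ dc(per_n)` is not quasi-polynomially bounded. Proof: a bound with constant `c` yields, at
`n := n₀(c+1)` and `m := max (dc per_n) (max n 1)`, a determinantal representation of size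
`m ∈ [n, 2^((log₂ n + c + 1)^(c+1))]`, hence `X₀₀^(m-n) per_n ∈ Δ[det_m]`, contradicting the
thesis. [folklore] -/
theorem gct_assembly :
    (∀ c : ℕ, ∃ n₀ : ℕ, ∀ n ≥ n₀, ∀ (m : ℕ) [NeZero m], n ≤ m → m ≤ 2 ^ ((Nat.log 2 n + c) ^ c) →
      Literature.Computability.AlgebraicComplexity.paddedPerPoly ℂ n m ∉ Literature.Computability.AlgebraicComplexity.orbitClosure (Literature.Computability.AlgebraicComplexity.detPoly (Fin m) ℂ)) →
    @Literature.Computability.AlgebraicComplexity.paddedPerPoly_mem_orbitClosure_detPoly_of_hasDetRepr ℂ _ →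
    (∀ n : ℕ, Literature.Computability.AlgebraicComplexity.HasDetRepr (Literature.Computability.AlgebraicComplexity.perPoly (Fin n) ℂ)
      (Literature.Computability.AlgebraicComplexity.determinantalComplexity (Literature.Computability.AlgebraicComplexity.perPoly (Fin n) ℂ))) →
    (∀ n m m' : ℕ, Literature.Computability.AlgebraicComplexity.HasDetRepr (Literature.Computability.AlgebraicComplexity.perPoly (Fin n) ℂ) m → m ≤ m' →
      Literature.Computability.AlgebraicComplexity.HasDetRepr (Literature.Computability.AlgebraicComplexity.perPoly (Fin n) ℂ) m') →
    ¬ Literature.Computability.AlgebraicComplexity.IsQPBounded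
      (fun n => Literature.Computability.AlgebraicComplexity.determinantalComplexity (Literature.Computability.AlgebraicComplexity.perPoly (Fin n) ℂ)) := by
  intro hX hMS hatt hmono hqp
  obtain ⟨c, hc⟩ := hqp
  obtain ⟨n, hn₀⟩ := hX (c + 1)
  set t := Literature.Computability.AlgebraicComplexity.determinantalComplexity (Literature.Computability.AlgebraicComplexity.perPoly (Fin n) ℂ) with ht
  set m := max t (max n 1) with hm
  haveI : NeZero m := NeZero.of_pos (by omega)
  have hnm : n ≤ m := by omega
  have htm : t ≤ m := le_max_left _ _
  have hbound : m ≤ 2 ^ ((Nat.log 2 n + (c + 1)) ^ (c + 1)) := by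
    have h1 : t ≤ 2 ^ ((Nat.log 2 n + (c + 1)) ^ (c + 1)) :=
      (hc n).trans (Nat.pow_le_pow_right (by norm_num) (add_pow_le_add_succ_pow_succ _ _))
    have h2 : n ≤ 2 ^ ((Nat.log 2 n + (c + 1)) ^ (c + 1)) := by
      have : n < 2 ^ (Nat.log 2 n + 1) := Nat.lt_pow_succ_log_self (by norm_num) n
      have : Nat.log 2 n + 1 ≤ (Nat.log 2 n + (c + 1)) ^ (c + 1) :=
        calc Nat.log 2 n + 1 ≤ Nat.log 2 n + (c + 1) := by omega
          _ ≤ (Nat.log 2 n + (c + 1)) ^ (c + 1) := Nat.le_self_pow (by omega) _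
      have : 2 ^ (Nat.log 2 n + 1) ≤ 2 ^ ((Nat.log 2 n + (c + 1)) ^ (c + 1)) :=
        Nat.pow_le_pow_right (by norm_num) this
      omega
    have h3 : 1 ≤ 2 ^ ((Nat.log 2 n + (c + 1)) ^ (c + 1)) := Nat.one_le_two_pow
    omega
  have hrep : Literature.Computability.AlgebraicComplexity.HasDetRepr (Literature.Computability.AlgebraicComplexity.perPoly (Fin n) ℂ) m :=
    hmono n t m (hatt n) htm
  exact hn₀ n le_rfl m hnm hbound (hMS hrep hnm)

end Literature.CplxAlg
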